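import Mathlib.MeasureTheory.Function.L2Space
import Mathlib.MeasureTheory.Integral.Bochner.Basic
import HarnessLib

/-!
# Polarisation of an `L²`-norm identity

KERNEL helper (generic measure theory). If a map `T : (Y → ℂ) → (X → ℂ)` is additive-homogeneous
(`T (f + a g) = T f + a T g`) and satisfies the norm identity `∫ ‖T f‖² dμ = c ∫ ‖f‖² dν` for all
measurable `f` (as an identity of lower integrals, `c < ∞`), then it satisfies the inner-product
identity `∫ conj (T g) · T f dμ = c ∫ conj g · f dν` for measurable `f, g ∈ L²(ν)`
(`integral_conj_mul_eq_of_sq`) — by integrating the pointwise polarisation identity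
`conj b · a = ¼[(‖a+b‖² − ‖a−b‖²) + i(‖a+ib‖² − ‖a−ib‖²)]` (`conj_mul_eq_polar`).
(`‖z‖ₑ² = ofReal ‖z‖²` is `Literature.Analysis.Fourier.Prop31.enorm_sq_eq_ofReal`; inlined here to keep
the imports Mathlib-only.)
Used by `UnitaryBallPeterssonDescent` (Baily's `∫_G |′f|² dg = c ∫_D |f|² dv` ⇒ the Petersson
pairing unfolds to the ball). Also: the bridges between `∫⁻ ‖h‖ₑ²`, `∫ ‖h‖²` and `MemLp h 2`.
-/

noncomputable section

open MeasureTheory Complex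
open scoped ComplexConjugate ENNReal

namespace Literature.MeasureTheory.Integral

variable {X : Type*} [MeasurableSpace X] {μ : Measure X}

/-- Pointwise polarisation: `conj b · a = ¼[(‖a+b‖² − ‖a−b‖²) + i(‖a+ib‖² − ‖a−ib‖²)]`.
[folklore] -/
theorem conj_mul_eq_polar (a b : ℂ) :
    conj b * a = (1 / 4 : ℂ) * ((((‖a + b‖ ^ 2 : ℝ) : ℂ) - ((‖a - b‖ ^ 2 : ℝ) : ℂ))
      + I * (((‖a + I * b‖ ^ 2 : ℝ) : ℂ) - ((‖a - I * b‖ ^ 2 : ℝ) : ℂ))) := by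
  apply Complex.ext
  · simp only [Complex.sq_norm, Complex.normSq_apply, mul_re, mul_im, add_re, add_im, sub_re,
      sub_im, conj_re, conj_im, I_re, I_im, ofReal_re, ofReal_im]
    norm_num
    ring
  · simp only [Complex.sq_norm, Complex.normSq_apply, mul_re, mul_im, add_re, add_im, sub_re,
      sub_im, conj_re, conj_im, I_re, I_im, ofReal_re, ofReal_im]
    norm_num
    ring

/-- `‖h‖²` is integrable when `∫⁻ ‖h‖ₑ² < ∞`. [folklore] -/
theorem integrable_norm_sq_of_lintegral {h : X → ℂ} (hm : AEStronglyMeasurable h μ)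
    (hfin : ∫⁻ x, ‖h x‖ₑ ^ 2 ∂μ < ⊤) : Integrable (fun x ↦ (‖h x‖ ^ 2 : ℝ)) μ := by
  refine ⟨(hm.norm.pow 2), ?_⟩
  rw [HasFiniteIntegral]
  convert hfin using 1
  refine lintegral_congr fun x ↦ ?_
  rw [Real.enorm_eq_ofReal (by positivity), ← ofReal_norm, ENNReal.ofReal_pow (norm_nonneg _)]

/-- `h ∈ L²` when `∫⁻ ‖h‖ₑ² < ∞`. [folklore] -/
theorem memLp_two_of_lintegral {h : X → ℂ} (hm : AEStronglyMeasurable h μ)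
    (hfin : ∫⁻ x, ‖h x‖ₑ ^ 2 ∂μ < ⊤) : MemLp h 2 μ :=
  (memLp_two_iff_integrable_sq_norm hm).2 (integrable_norm_sq_of_lintegral hm hfin)

/-- `∫⁻ ‖h‖ₑ² < ∞` when `h ∈ L²`. [folklore] -/
theorem lintegral_lt_top_of_memLp {h : X → ℂ} (h2 : MemLp h 2 μ) :
    ∫⁻ x, ‖h x‖ₑ ^ 2 ∂μ < ⊤ := by
  have hi := ((memLp_two_iff_integrable_sq_norm h2.1).1 h2).2
  rw [HasFiniteIntegral] at hi
  convert hi using 1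
  refine lintegral_congr fun x ↦ ?_
  rw [Real.enorm_eq_ofReal (by positivity), ← ofReal_norm, ENNReal.ofReal_pow (norm_nonneg _)]

/-- `∫ ‖h‖² = (∫⁻ ‖h‖ₑ²).toReal`. [folklore] -/
theorem integral_norm_sq_eq_toReal {h : X → ℂ} (hm : AEStronglyMeasurable h μ) :
    ∫ x, (‖h x‖ ^ 2 : ℝ) ∂μ = (∫⁻ x, ‖h x‖ₑ ^ 2 ∂μ).toReal := by
  have hm2 : AEStronglyMeasurable (fun x ↦ (‖h x‖ ^ 2 : ℝ)) μ := hm.norm.pow 2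
  rw [integral_eq_lintegral_of_nonneg_ae (Filter.Eventually.of_forall fun x ↦ by positivity) hm2]
  congr 1
  exact lintegral_congr fun x ↦ by rw [← ofReal_norm, ENNReal.ofReal_pow (norm_nonneg _)]

variable {Y : Type*} [MeasurableSpace Y] {ν : Measure Y}

/-- **Polarisation of a norm identity.** If `T` is additive-homogeneous and
`∫ ‖T f‖² dμ = c ∫ ‖f‖² dν` for all measurable `f` (`c < ∞`), then
`∫ conj (T g) · T f dμ = c ∫ conj g · f dν` for measurable `f, g ∈ L²(ν)`. [folklore] -/
theorem integral_conj_mul_eq_of_sq {c : ℝ≥0∞} (hc : c ≠ ⊤) (T : (Y → ℂ) → X → ℂ)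
    (hT : ∀ (a : ℂ) (f g : Y → ℂ), T (f + a • g) = T f + a • T g)
    (hTm : ∀ f, Measurable f → AEStronglyMeasurable (T f) μ)
    (hR : ∀ f, Measurable f → ∫⁻ x, ‖T f x‖ₑ ^ 2 ∂μ = c * ∫⁻ y, ‖f y‖ₑ ^ 2 ∂ν)
    {f g : Y → ℂ} (hf : Measurable f) (hg : Measurable g) (hf2 : MemLp f 2 ν)
    (hg2 : MemLp g 2 ν) :
    ∫ x, conj (T g x) * T f x ∂μ = (c.toReal : ℂ) * ∫ y, conj (g y) * f y ∂ν := by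
  have key : ∀ a : ℂ,
      Integrable (fun y ↦ (‖f y + a * g y‖ ^ 2 : ℝ)) ν ∧
      Integrable (fun x ↦ (‖T f x + a * T g x‖ ^ 2 : ℝ)) μ ∧
      ∫ x, (‖T f x + a * T g x‖ ^ 2 : ℝ) ∂μ = c.toReal * ∫ y, (‖f y + a * g y‖ ^ 2 : ℝ) ∂ν := by
    intro a
    have hm : Measurable (f + a • g) := hf.add (hg.const_smul a)
    have h2 : MemLp (f + a • g) 2 ν := hf2.add (hg2.const_smul a)
    have hfin := lintegral_lt_top_of_memLp h2
    have hRa := hR _ hm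
    have hTfin : ∫⁻ x, ‖T (f + a • g) x‖ₑ ^ 2 ∂μ < ⊤ := by
      rw [hRa]; exact ENNReal.mul_lt_top hc.lt_top hfin
    have hTa : T (f + a • g) = fun x ↦ T f x + a * T g x := by
      rw [hT]; ext x; simp
    have hfa : (f + a • g) = fun y ↦ f y + a * g y := by ext y; simp
    refine ⟨?_, ?_, ?_⟩
    · simpa only [hfa] using integrable_norm_sq_of_lintegral h2.1 hfin
    · simpa only [hTa] using integrable_norm_sq_of_lintegral (hTm _ hm) hTfin
    · have h1 := integral_norm_sq_eq_toReal (μ := μ) (hTm _ hm)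
      have h2' := integral_norm_sq_eq_toReal (μ := ν) h2.1
      rw [hTa] at h1
      rw [hfa] at h2'
      rw [hTa, hfa] at hRa
      simp only at h1 h2' hRa
      rw [h1, h2', hRa, ENNReal.toReal_mul]
  obtain ⟨i1, j1, e1⟩ := key 1
  obtain ⟨i2, j2, e2⟩ := key (-1)
  obtain ⟨i3, j3, e3⟩ := key I
  obtain ⟨i4, j4, e4⟩ := key (-I)
  simp only [one_mul, neg_mul, ← sub_eq_add_neg] at i1 j1 e1 i2 j2 e2 i3 j3 e3 i4 j4 e4
  have lhs : ∫ x, conj (T g x) * T f x ∂μ =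
      (1 / 4 : ℂ) * ((((∫ x, (‖T f x + T g x‖ ^ 2 : ℝ) ∂μ : ℝ) : ℂ) -
        ((∫ x, (‖T f x - T g x‖ ^ 2 : ℝ) ∂μ : ℝ) : ℂ)) +
        I * ((((∫ x, (‖T f x + I * T g x‖ ^ 2 : ℝ) ∂μ : ℝ) : ℂ)) -
          ((∫ x, (‖T f x - I * T g x‖ ^ 2 : ℝ) ∂μ : ℝ) : ℂ))) := by
    simp_rw [conj_mul_eq_polar (T f _) (T g _)]
    rw [integral_const_mul, integral_add, integral_sub, integral_const_mul, integral_sub,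
      integral_complex_ofReal, integral_complex_ofReal, integral_complex_ofReal,
      integral_complex_ofReal]
    · exact j3.ofReal
    · exact j4.ofReal
    · exact j1.ofReal
    · exact j2.ofReal
    · exact (j1.ofReal).sub (j2.ofReal)
    · exact ((j3.ofReal).sub (j4.ofReal)).const_mul I
  have rhs : ∫ y, conj (g y) * f y ∂ν =
      (1 / 4 : ℂ) * ((((∫ y, (‖f y + g y‖ ^ 2 : ℝ) ∂ν : ℝ) : ℂ) -
        ((∫ y, (‖f y - g y‖ ^ 2 : ℝ) ∂ν : ℝ) : ℂ)) +
        I * ((((∫ y, (‖f y + I * g y‖ ^ 2 : ℝ) ∂ν : ℝ) : ℂ)) -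
          ((∫ y, (‖f y - I * g y‖ ^ 2 : ℝ) ∂ν : ℝ) : ℂ))) := by
    simp_rw [conj_mul_eq_polar (f _) (g _)]
    rw [integral_const_mul, integral_add, integral_sub, integral_const_mul, integral_sub,
      integral_complex_ofReal, integral_complex_ofReal, integral_complex_ofReal,
      integral_complex_ofReal]
    · exact i3.ofReal
    · exact i4.ofReal
    · exact i1.ofReal
    · exact i2.ofReal
    · exact (i1.ofReal).sub (i2.ofReal)
    · exact ((i3.ofReal).sub (i4.ofReal)).const_mul I
  rw [lhs, rhs, e1, e2, e3, e4]
  push_cast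
  ring

end Literature.MeasureTheory.Integral

end
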